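import Mathlib
import Summits.AtomisticToContinuum.Crystallization.Theorems.ChessboardParticlePlanesLjBilayerHcpNumericReductionSums

/-!
# Crux `ChessboardParticlePlanes.LjBilayerHcp` (stmt-AtomisticToContinuum-6710), line `Sketch` —
# certificate stub N4: bridge from exact rational box sums to the real inequalities

The certificate `stub_certificate` of the line asserts finitely many inequalities between the REAL box partial sums
`B n x = ∑_{|k|,|i|,|j| ≤ 12} [v ≠ 0](Q v + k²x²)⁻ⁿ`, the tail bound `T x` and rational constants, at rational points `x`.
This file reduces each ingredient to a COMPUTABLE rational expression indexed by `Finset.range 25` (index shift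
`w ↦ w − 12`; `Finset.Icc` on `ℤ` does not compile for `native_decide`), with floor rounding at denominator `2⁶⁰`:

* `sum_box_shift`, `boxSum_eq_cast` — the real box sum at a rational point is the cast of the shifted rational sum;
* `floorSum_div_le`, `le_floorSum_add_card_div` — `(∑ ⌊g·D⌋)/D ≤ ∑ g ≤ (∑ ⌊g·D⌋ + #I)/D`;
* `boxSum_ge_floor`, `boxSum_le_floor` — the two-sided enclosure of `B n q` by the floor sum `FS n q`;
* `tailBound_eq_cast`, `tailBound_nonneg`, `rho_cast`, `inplane_ge_floor`.

The clause bridges are in the certificate files.  All `[folklore]`; no definitions; `Classical` is not opened (the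
`if Even k` of the rational sums keeps its computable instance).
-/

noncomputable section

open scoped BigOperators

namespace Summit.AtomisticToContinuum.Crystallization.Theorems.LjBilayerHcpSketch

/-! ## Re-indexing the box by `Finset.range 25` -/

/-- **Index shift**: a sum over the box `Icc (-12) 12 ³` is the sum over `range 25 ³` of the shifted family. [folklore] -/
theorem sum_box_shift {M : Type*} [AddCommMonoid M] (g : ℤ × ℤ × ℤ → M) :
    (∑ v ∈ Finset.Icc (-12 : ℤ) 12 ×ˢ (Finset.Icc (-12 : ℤ) 12 ×ˢ Finset.Icc (-12 : ℤ) 12), g v) =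
      ∑ w ∈ Finset.range 25 ×ˢ (Finset.range 25 ×ˢ Finset.range 25),
        g ((w.1 : ℤ) - 12, (w.2.1 : ℤ) - 12, (w.2.2 : ℤ) - 12) := by
  symm
  refine Finset.sum_nbij' (fun w : ℕ × ℕ × ℕ => ((w.1 : ℤ) - 12, (w.2.1 : ℤ) - 12, (w.2.2 : ℤ) - 12))
    (fun v : ℤ × ℤ × ℤ => ((v.1 + 12).toNat, (v.2.1 + 12).toNat, (v.2.2 + 12).toNat)) ?_ ?_ ?_ ?_
    (fun _ _ => rfl)
  · intro w hw
    simp only [Finset.mem_product, Finset.mem_Icc, Finset.mem_range] at hw ⊢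
    omega
  · intro v hv
    simp only [Finset.mem_product, Finset.mem_Icc, Finset.mem_range] at hv ⊢
    omega
  · intro w hw
    obtain ⟨k, i, j⟩ := w
    simp
  · intro v hv
    obtain ⟨k, i, j⟩ := v
    simp only [Finset.mem_product, Finset.mem_Icc] at hv
    have hk : (((k + 12).toNat : ℕ) : ℤ) - 12 = k := by omega
    have hi : (((i + 12).toNat : ℕ) : ℤ) - 12 = i := by omega
    have hj : (((j + 12).toNat : ℕ) : ℤ) - 12 = j := by omega
    simp only [hk, hi, hj]

/-- **The real box sum at a rational point is the cast of the shifted rational box sum.** [folklore] -/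
theorem boxSum_eq_cast (Q : ℤ × ℤ × ℤ → ℝ)
    (hQ : Q = fun v => (v.2.1 : ℝ) ^ 2 + (v.2.1 : ℝ) * v.2.2 + (v.2.2 : ℝ) ^ 2 +
      (if Even v.1 then 0 else ((v.2.1 : ℝ) + v.2.2 + 1 / 3)))
    (n : ℕ) (q : ℚ) :
    (∑ v ∈ Finset.Icc (-12 : ℤ) 12 ×ˢ (Finset.Icc (-12 : ℤ) 12 ×ˢ Finset.Icc (-12 : ℤ) 12),
        if v = 0 then (0 : ℝ) else ((Q v + (v.1 : ℝ) ^ 2 * (q : ℝ) ^ 2)⁻¹) ^ n) =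
      ((∑ w ∈ Finset.range 25 ×ˢ (Finset.range 25 ×ˢ Finset.range 25),
        (if w = ((12 : ℕ), (12 : ℕ), (12 : ℕ)) then (0 : ℚ) else
          (((((w.2.1 : ℚ) - 12) ^ 2 + ((w.2.1 : ℚ) - 12) * ((w.2.2 : ℚ) - 12) + ((w.2.2 : ℚ) - 12) ^ 2 +
              (if Even w.1 then 0 else (((w.2.1 : ℚ) - 12) + ((w.2.2 : ℚ) - 12) + 1 / 3))) +
            ((w.1 : ℚ) - 12) ^ 2 * q ^ 2)⁻¹) ^ n) : ℚ) : ℝ) := by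
  rw [sum_box_shift, Rat.cast_sum]
  refine Finset.sum_congr rfl fun w _ => ?_
  obtain ⟨k, i, j⟩ := w
  have hzero : (((k : ℤ) - 12, (i : ℤ) - 12, (j : ℤ) - 12) = (0 : ℤ × ℤ × ℤ)) ↔
      ((k, i, j) = ((12 : ℕ), (12 : ℕ), (12 : ℕ))) := by
    simp only [Prod.ext_iff, Prod.fst_zero, Prod.snd_zero]
    omega
  have heven : Even ((k : ℤ) - 12) ↔ Even k := by
    rw [Int.even_sub, Int.even_coe_nat]
    norm_num
  dsimp only
  rw [hQ]
  dsimp only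
  rw [if_congr hzero rfl rfl]
  by_cases h0 : (k, i, j) = ((12 : ℕ), (12 : ℕ), (12 : ℕ))
  · rw [if_pos h0, if_pos h0]; simp
  · rw [if_neg h0, if_neg h0]
    by_cases he : Even k
    · rw [if_pos (heven.2 he), if_pos he]; push_cast; ring
    · rw [if_neg (fun h => he (heven.1 h)), if_neg he]; push_cast; ring

/-! ## Floor enclosure of a rational sum -/

/-- **Lower floor enclosure**: `(∑ ⌊g v · D⌋) / D ≤ ∑ g v` for `D > 0`. [folklore] -/
theorem floorSum_div_le {ι : Type*} (I : Finset ι) (g : ι → ℚ) {D : ℚ} (hD : 0 < D) :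
    ((∑ v ∈ I, ⌊g v * D⌋ : ℤ) : ℚ) / D ≤ ∑ v ∈ I, g v := by
  rw [div_le_iff₀ hD, Int.cast_sum, Finset.sum_mul]
  exact Finset.sum_le_sum fun v _ => Int.floor_le _

/-- **Upper floor enclosure**: `∑ g v ≤ (∑ ⌊g v · D⌋ + #I) / D` for `D > 0`. [folklore] -/
theorem le_floorSum_add_card_div {ι : Type*} (I : Finset ι) (g : ι → ℚ) {D : ℚ} (hD : 0 < D) :
    ∑ v ∈ I, g v ≤ (((∑ v ∈ I, ⌊g v * D⌋ : ℤ) : ℚ) + I.card) / D := by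
  rw [le_div_iff₀ hD, Int.cast_sum, Finset.sum_mul, Finset.card_eq_sum_ones, Nat.cast_sum,
    ← Finset.sum_add_distrib]
  exact Finset.sum_le_sum fun v _ => by
    have := Int.lt_floor_add_one (g v * D)
    push_cast
    linarith

/-- The shifted index box has `25³ = 15625` elements. [folklore] -/
theorem card_rangeBox : (Finset.range 25 ×ˢ (Finset.range 25 ×ˢ Finset.range 25)).card = 15625 := by
  simp

/-- **Lower enclosure of the real box sum** by the floor sum `FS n q` at denominator `2⁶⁰`. [folklore] -/
theorem boxSum_ge_floor (Q : ℤ × ℤ × ℤ → ℝ)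
    (hQ : Q = fun v => (v.2.1 : ℝ) ^ 2 + (v.2.1 : ℝ) * v.2.2 + (v.2.2 : ℝ) ^ 2 +
      (if Even v.1 then 0 else ((v.2.1 : ℝ) + v.2.2 + 1 / 3)))
    (n : ℕ) (q : ℚ) :
    ((((∑ w ∈ Finset.range 25 ×ˢ (Finset.range 25 ×ˢ Finset.range 25),
        ⌊(if w = ((12 : ℕ), (12 : ℕ), (12 : ℕ)) then (0 : ℚ) else
          (((((w.2.1 : ℚ) - 12) ^ 2 + ((w.2.1 : ℚ) - 12) * ((w.2.2 : ℚ) - 12) + ((w.2.2 : ℚ) - 12) ^ 2 +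
              (if Even w.1 then 0 else (((w.2.1 : ℚ) - 12) + ((w.2.2 : ℚ) - 12) + 1 / 3))) +
            ((w.1 : ℚ) - 12) ^ 2 * q ^ 2)⁻¹) ^ n) * 2 ^ 60⌋ : ℤ) : ℚ) / 2 ^ 60 : ℚ) : ℝ) ≤
      ∑ v ∈ Finset.Icc (-12 : ℤ) 12 ×ˢ (Finset.Icc (-12 : ℤ) 12 ×ˢ Finset.Icc (-12 : ℤ) 12),
        if v = 0 then (0 : ℝ) else ((Q v + (v.1 : ℝ) ^ 2 * (q : ℝ) ^ 2)⁻¹) ^ n := by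
  rw [boxSum_eq_cast Q hQ n q]
  exact_mod_cast floorSum_div_le _ _ (by norm_num : (0 : ℚ) < 2 ^ 60)

/-- **Upper enclosure of the real box sum** by the floor sum `FS n q` plus `15625`, at denominator `2⁶⁰`. [folklore] -/
theorem boxSum_le_floor (Q : ℤ × ℤ × ℤ → ℝ)
    (hQ : Q = fun v => (v.2.1 : ℝ) ^ 2 + (v.2.1 : ℝ) * v.2.2 + (v.2.2 : ℝ) ^ 2 +
      (if Even v.1 then 0 else ((v.2.1 : ℝ) + v.2.2 + 1 / 3)))
    (n : ℕ) (q : ℚ) :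
    (∑ v ∈ Finset.Icc (-12 : ℤ) 12 ×ˢ (Finset.Icc (-12 : ℤ) 12 ×ˢ Finset.Icc (-12 : ℤ) 12),
        if v = 0 then (0 : ℝ) else ((Q v + (v.1 : ℝ) ^ 2 * (q : ℝ) ^ 2)⁻¹) ^ n) ≤
      (((((∑ w ∈ Finset.range 25 ×ˢ (Finset.range 25 ×ˢ Finset.range 25),
        ⌊(if w = ((12 : ℕ), (12 : ℕ), (12 : ℕ)) then (0 : ℚ) else
          (((((w.2.1 : ℚ) - 12) ^ 2 + ((w.2.1 : ℚ) - 12) * ((w.2.2 : ℚ) - 12) + ((w.2.2 : ℚ) - 12) ^ 2 +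
              (if Even w.1 then 0 else (((w.2.1 : ℚ) - 12) + ((w.2.2 : ℚ) - 12) + 1 / 3))) +
            ((w.1 : ℚ) - 12) ^ 2 * q ^ 2)⁻¹) ^ n) * 2 ^ 60⌋ : ℤ) : ℚ) + 15625) / 2 ^ 60 : ℚ) : ℝ) := by
  rw [boxSum_eq_cast Q hQ n q]
  have := le_floorSum_add_card_div (Finset.range 25 ×ˢ (Finset.range 25 ×ˢ Finset.range 25))
    (fun w : ℕ × ℕ × ℕ => (if w = ((12 : ℕ), (12 : ℕ), (12 : ℕ)) then (0 : ℚ) else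
          (((((w.2.1 : ℚ) - 12) ^ 2 + ((w.2.1 : ℚ) - 12) * ((w.2.2 : ℚ) - 12) + ((w.2.2 : ℚ) - 12) ^ 2 +
              (if Even w.1 then 0 else (((w.2.1 : ℚ) - 12) + ((w.2.2 : ℚ) - 12) + 1 / 3))) +
            ((w.1 : ℚ) - 12) ^ 2 * q ^ 2)⁻¹) ^ n)) (by norm_num : (0 : ℚ) < 2 ^ 60)
  rw [card_rangeBox] at this
  exact_mod_cast this

/-! ## The tail bound, `ρ`, the in-plane sum -/

/-- **The tail bound at a rational point is the cast of a `range 25`-indexed rational value.** [folklore] -/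
theorem tailBound_eq_cast (T : ℝ → ℝ)
    (hT : T = fun x => (∑ k ∈ Finset.Icc (-((12 : ℕ) : ℤ)) ((12 : ℕ) : ℤ),
        (4608 : ℝ) / (5 * ((3 * ((12 : ℕ) : ℝ) - 2) ^ 2 + 12 * (k : ℝ) ^ 2 * x ^ 2) ^ 2)) +
        64 / (15 * ((12 : ℕ) : ℝ) ^ 3 * x ^ 4) + 18 / (5 * ((12 : ℕ) : ℝ) ^ 5 * x ^ 6))
    (q : ℚ) :
    T (q : ℝ) = (((∑ k ∈ Finset.range 25,
        (4608 : ℚ) / (5 * (1156 + 12 * ((k : ℚ) - 12) ^ 2 * q ^ 2) ^ 2)) +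
        64 / (25920 * q ^ 4) + 18 / (1244160 * q ^ 6) : ℚ) : ℝ) := by
  rw [hT]
  dsimp only
  have hshift : ∀ f : ℤ → ℝ, (∑ k ∈ Finset.Icc (-((12 : ℕ) : ℤ)) ((12 : ℕ) : ℤ), f k) =
      ∑ k ∈ Finset.range 25, f ((k : ℤ) - 12) := by
    intro f
    symm
    refine Finset.sum_nbij' (fun k : ℕ => (k : ℤ) - 12) (fun k : ℤ => (k + 12).toNat) ?_ ?_ ?_ ?_
      (fun _ _ => rfl)
    · intro k hk; simp only [Finset.mem_Icc, Finset.mem_range] at hk ⊢; omega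
    · intro k hk; simp only [Finset.mem_Icc, Finset.mem_range] at hk ⊢; omega
    · intro k hk; simp
    · intro k hk; simp only [Finset.mem_Icc] at hk; omega
  rw [hshift]
  push_cast
  congr 1
  · congr 1
    · refine Finset.sum_congr rfl fun k _ => ?_
      ring
    · ring
  · ring

/-- **The tail bound is non-negative** (every summand is a quotient of non-negative reals). [folklore] -/
theorem tailBound_nonneg (T : ℝ → ℝ)
    (hT : T = fun x => (∑ k ∈ Finset.Icc (-((12 : ℕ) : ℤ)) ((12 : ℕ) : ℤ),
        (4608 : ℝ) / (5 * ((3 * ((12 : ℕ) : ℝ) - 2) ^ 2 + 12 * (k : ℝ) ^ 2 * x ^ 2) ^ 2)) +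
        64 / (15 * ((12 : ℕ) : ℝ) ^ 3 * x ^ 4) + 18 / (5 * ((12 : ℕ) : ℝ) ^ 5 * x ^ 6))
    (x : ℝ) : 0 ≤ T x := by
  rw [hT]
  dsimp only
  have h4 : 0 ≤ x ^ 4 := by positivity
  have h6 : 0 ≤ x ^ 6 := by positivity
  refine add_nonneg (add_nonneg (Finset.sum_nonneg fun k _ => ?_) ?_) ?_
  · exact div_nonneg (by norm_num) (by positivity)
  · exact div_nonneg (by norm_num) (by positivity)
  · exact div_nonneg (by norm_num) (by positivity)

/-- **`ρ` at a rational point is the cast of its rational value.** [folklore] -/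
theorem rho_cast (q : ℚ) :
    (min 1 (min (1 / 3 + (q : ℝ) ^ 2) (4 * (q : ℝ) ^ 2)) : ℝ) =
      ((min 1 (min (1 / 3 + q ^ 2) (4 * q ^ 2)) : ℚ) : ℝ) := by
  push_cast
  rfl


/-- **Registered sub-goal `certBridge_rho_cast` (anchor of this helper file):** binder-free spelling of `rho_cast`.
[folklore] -/
theorem certBridge_rho_cast :
    ∀ q : ℚ, (min 1 (min (1 / 3 + (q : ℝ) ^ 2) (4 * (q : ℝ) ^ 2)) : ℝ) =
      ((min 1 (min (1 / 3 + q ^ 2) (4 * q ^ 2)) : ℚ) : ℝ) :=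
  fun q => rho_cast q

/-- **Lower enclosure of the in-plane sum** `∑_{|i|,|j| ≤ 12} [p ≠ 0](i² + ij + j²)⁻⁶` by a `range 25²`-indexed floor sum. [folklore] -/
theorem inplane_ge_floor :
    ((((∑ w ∈ Finset.range 25 ×ˢ Finset.range 25,
        ⌊(if w = ((12 : ℕ), (12 : ℕ)) then (0 : ℚ) else
          (((((w.1 : ℚ) - 12) ^ 2 + ((w.1 : ℚ) - 12) * ((w.2 : ℚ) - 12) + ((w.2 : ℚ) - 12) ^ 2))⁻¹) ^ 6) *
            2 ^ 60⌋ : ℤ) : ℚ) / 2 ^ 60 : ℚ) : ℝ) ≤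
      ∑ p ∈ Finset.Icc (-12 : ℤ) 12 ×ˢ Finset.Icc (-12 : ℤ) 12,
        if p = 0 then (0 : ℝ) else (((p.1 : ℝ) ^ 2 + (p.1 : ℝ) * p.2 + (p.2 : ℝ) ^ 2)⁻¹) ^ 6 := by
  have hshift : ∀ f : ℤ × ℤ → ℝ, (∑ p ∈ Finset.Icc (-12 : ℤ) 12 ×ˢ Finset.Icc (-12 : ℤ) 12, f p) =
      ∑ w ∈ Finset.range 25 ×ˢ Finset.range 25, f ((w.1 : ℤ) - 12, (w.2 : ℤ) - 12) := by
    intro f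
    symm
    refine Finset.sum_nbij' (fun w : ℕ × ℕ => ((w.1 : ℤ) - 12, (w.2 : ℤ) - 12))
      (fun p : ℤ × ℤ => ((p.1 + 12).toNat, (p.2 + 12).toNat)) ?_ ?_ ?_ ?_ (fun _ _ => rfl)
    · intro w hw; simp only [Finset.mem_product, Finset.mem_Icc, Finset.mem_range] at hw ⊢; omega
    · intro p hp; simp only [Finset.mem_product, Finset.mem_Icc, Finset.mem_range] at hp ⊢; omega
    · intro w hw; obtain ⟨i, j⟩ := w; simp
    · intro p hp
      obtain ⟨i, j⟩ := p
      simp only [Finset.mem_product, Finset.mem_Icc] at hp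
      have hi : (((i + 12).toNat : ℕ) : ℤ) - 12 = i := by omega
      have hj : (((j + 12).toNat : ℕ) : ℤ) - 12 = j := by omega
      simp only [hi, hj]
  have hcast : (∑ p ∈ Finset.Icc (-12 : ℤ) 12 ×ˢ Finset.Icc (-12 : ℤ) 12,
      if p = 0 then (0 : ℝ) else (((p.1 : ℝ) ^ 2 + (p.1 : ℝ) * p.2 + (p.2 : ℝ) ^ 2)⁻¹) ^ 6) =
      ((∑ w ∈ Finset.range 25 ×ˢ Finset.range 25,
        (if w = ((12 : ℕ), (12 : ℕ)) then (0 : ℚ) else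
          (((((w.1 : ℚ) - 12) ^ 2 + ((w.1 : ℚ) - 12) * ((w.2 : ℚ) - 12) + ((w.2 : ℚ) - 12) ^ 2))⁻¹) ^ 6) : ℚ) : ℝ) := by
    rw [hshift, Rat.cast_sum]
    refine Finset.sum_congr rfl fun w _ => ?_
    obtain ⟨i, j⟩ := w
    have hzero : (((i : ℤ) - 12, (j : ℤ) - 12) = (0 : ℤ × ℤ)) ↔ ((i, j) = ((12 : ℕ), (12 : ℕ))) := by
      simp only [Prod.ext_iff, Prod.fst_zero, Prod.snd_zero]
      omega
    dsimp only
    rw [if_congr hzero rfl rfl]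
    split_ifs
    · simp
    · push_cast; ring
  rw [hcast]
  exact_mod_cast floorSum_div_le _ _ (by norm_num : (0 : ℚ) < 2 ^ 60)

end Summit.AtomisticToContinuum.Crystallization.Theorems.LjBilayerHcpSketch

end
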